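import Summits.Langlands.Langlands.Statement
import Summits.Langlands.Langlands.Theorems.SmithKummerSeedCyclicPrimeDescentReducibleSeams
import Summits.Langlands.Langlands.Theorems.IrreducibilityBySelfDualityIrreducibleOffSectorInductionAscent
import Literature.NumberTheory.GaloisRepresentations.CliffordConstituentGeometric
import Literature.NumberTheory.Automorphic.AutomorphicInductionCuspidal
import Literature.NumberTheory.Automorphic.HenniartAutomorphicInduction
import Literature.NumberTheory.Automorphic.InfinityTypeAutomorphicInduction
import Literature.NumberTheory.Automorphic.GLnAdelicStructureProofs
import Literature.NumberTheory.GaloisRepresentations.FramedRepBlockSum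
import Literature.NumberTheory.PAdicHodge.DeRhamBaseChange
import HarnessLib

/-!
# Weak direction (B) DESCENDS along a Galois layer of prime degree — the REDUCIBLE-restriction case
# (crux `AscentConjugationSolvable`, stmt-Langlands-1094; piece `CyclicPrimeDescent`, stmt-Langlands-18645;
# strategist stub `stub_descentWeakGalToAut`; lead c2 `--supports` helper)

Support file (closes nothing).  Companion of `SmithKummerSeedCyclicPrimeDescentWeakGalToAutIrreducible.lean` (p165721,
the case `ρ|_{Γ_L}` irreducible).  Here `ρ : Γ_K → GL_n(ℚ̄_ℓ)` is irreducible and `R`-geometric with `ρ|_{Γ_L}`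
REDUCIBLE, `L/K` Galois of prime degree, reciprocity over `L` in full, (A) over `K` available (unused in this
case); conclusion: some L-algebraic cuspidal `π` on `GL_n(𝔸_K)` is a.e. Satake–Frobenius compatible with `ρ`.
Conditional on exactly four undischarged named facts (explicit hypotheses): Arthur–Clozel's automorphic induction
`automorphicInduction_cyclic_cuspidal` (Ch. 3 Thm. 6.2), Henniart's archimedean clause
`Henniart2012_infinityType_of_automorphicInduction`, Clozel's existence of infinity types `exists_hasInfinityType`,
and Brinon–Conrad's `DeRhamBaseChange`.

Argument, every step a tree theorem: Clifford along the cyclic layer, strong form — `Q ρ Q⁻¹ = Ind_{Γ_L}^{Γ_K} s`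
for an irreducible `s : Γ_L → GL_m(ℚ̄_ℓ)`, `n = [L:K]·m`
(`exists_conj_eq_reindex_induce_of_not_isIrreducible_restrictField_of_prime`, p166527); `s` is geometric for the pinned
datum (`isUnramifiedAt_and_isDeRhamFramed_of_conj_eq_reindex_induce`, p168058: de Rham heredity of diagonal blocks,
Fontaine III Prop. 1.5.2, + `DeRhamBaseChange`); (B) over `L` in rank `m` gives the cuspidal L-algebraic avatar `π_s`;
`π_s` is NOT `Gal(L/K)`-stable (`not_isGaloisStableSatakeAE_of_conj_eq_induce`, p168118: else `s` extends to `Γ_K` and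
`ρ ∼ Ind(Res)` could not be irreducible); so Arthur–Clozel induce it to a cuspidal `P` on `GL_n(𝔸_K)`
(`automorphicInduction_cyclic_cuspidal`; the rank `m·[L:K]` of the fact is commuted to `[L:K]·m` by transport along
`Nat.mul_comm` with a proof-irrelevant level witness, `isCompact_glFiniteIntegralLevel_holds`); `P` is L-algebraic
(Henniart: its infinity type is the induced one, `hasInfinityType_automorphicInduction`, whose exponents are those
of `π_s`, `IsLAlgebraic.automorphicInduction`); and `P` is a.e. compatible with `Ind s`
(`IrreducibleOffSector.eventually_satakeFrobCompatibleAt_induce_rank`), i.e. with `Q ρ Q⁻¹`, i.e. with `ρ`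
(`satakeFrobCompatibleAt_conj`).

References: Arthur–Clozel, Ann. of Math. Stud. 120 (1989), Ch. 3 Thm. 6.2, Lemma 6.4; G. Henniart, *Induction automorphe
globale pour les corps de nombres*, Bull. SMF 140 (2012), Thm. 5; A. H. Clifford, Ann. of Math. 38 (1937), Thm. 1;
Barnet-Lamb–Gee–Geraghty–Taylor, Ann. of Math. 179 (2014), §5; Brinon–Conrad (2009), Prop. 6.3.8; Fontaine, Astérisque
223 (1994), Exp. III Prop. 1.5.2.
-/

noncomputable section

set_option linter.dupNamespace false -- project-wide option; `Summit.Langlands.Langlands` is the mandated namespace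

namespace Summit.Langlands.Langlands.Theorems.SmithKummerSeedCyclicPrimeDescent

open scoped MatrixGroups NumberField Classical Matrix Polynomial
open Filter IsDedekindDomain Field
open Literature.NumberTheory.Automorphic Literature.NumberTheory.GaloisRepresentations Literature.NumberTheory.PAdicHodge
open Summit.Langlands

/-- **Transport of a cuspidal automorphic induction along an equality of ranks** (`a = b`, level witnesses are
proof-irrelevant): used to commute the rank `m·[L:K]` of `automorphicInduction_cyclic_cuspidal` to `[L:K]·m`.
[folklore] -/
theorem exists_isAutomorphicInductionAlong_of_rank_eq {K E : Type} [Field K] [NumberField K] [Field E]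
    [NumberField E] [Algebra K E] {m : ℕ} {hE : isCompact_glFiniteIntegralLevel m E}
    (τ : AutomorphicRepData (AutomorphyDatum.gl m E hE)) {a b : ℕ} (hab : a = b)
    (hKa : isCompact_glFiniteIntegralLevel a K) (hKb : isCompact_glFiniteIntegralLevel b K)
    (h : ∃ P : CuspidalAutomorphicRepData a K hKa, IsAutomorphicInductionAlong τ P.1) :
    ∃ P : CuspidalAutomorphicRepData b K hKb, IsAutomorphicInductionAlong τ P.1 := by
  subst hab
  exact h

/-- **Registered stub `weakGalToAut_descent_of_reducible_restrictField` (crux stmt-Langlands-1094, lead c2): weak (B)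
over `K` from reciprocity over `L`, along a Galois layer `L/K` of PRIME degree, for the irreducible geometric `ρ` whose
restriction to `Γ_L` is REDUCIBLE** — conditionally on the named facts `automorphicInduction_cyclic_cuspidal`,
`Henniart2012_infinityType_of_automorphicInduction`, `exists_hasInfinityType` (all `π`), `DeRhamBaseChange`
(hypotheses, in this order).  The remaining binders are VERBATIM those of the strategist's `stub_descentWeakGalToAut`
with the extra hypothesis `¬ (ρ.restrictField L).toGaloisRep.IsIrreducible`.
[cite: ArthurClozelAMS120, Ch. 3 Thm. 6.2 and Lemma 6.4] [cite: Henniart2012, Thm. 5] [cite: Clifford1937, Thm. 1] -/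
theorem weakGalToAut_descent_of_reducible_restrictField : Literature.NumberTheory.Automorphic.automorphicInduction_cyclic_cuspidal → Literature.NumberTheory.Automorphic.Henniart2012_infinityType_of_automorphicInduction → (∀ (n : ℕ) (K : Type) [Field K] [NumberField K] (hK : Literature.NumberTheory.Automorphic.isCompact_glFiniteIntegralLevel n K) (π : Literature.NumberTheory.Automorphic.AutomorphicRepData (Literature.NumberTheory.Automorphic.AutomorphyDatum.gl n K hK)), π.exists_hasInfinityType) → Literature.NumberTheory.PAdicHodge.DeRhamBaseChange → ∀ (K L : Type) [Field K] [NumberField K] [Field L] [NumberField L] [Algebra K L] [IsGalois K L] (R : ReciprocityData K), (Module.finrank K L).Prime → (∃ R₁ : ReciprocityData L, ∀ n : ℕ, 0 < n → ∀ hcpt : Literature.NumberTheory.Automorphic.isCompact_glFiniteIntegralLevel n L, GlobalLanglandsCorrespondenceGLn n L R₁ hcpt) → (∀ n : ℕ, 0 < n → ∀ hcpt : Literature.NumberTheory.Automorphic.isCompact_glFiniteIntegralLevel n K, AutomorphicToGalois n R hcpt) → ∀ (n : ℕ), 0 < n → ∀ (ℓ : ℕ) [Fact ℓ.Prime] (ι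 : PadicAlgCl ℓ ≃+* ℂ) (ρ : Literature.NumberTheory.GaloisRepresentations.FramedGaloisRep K (PadicAlgCl ℓ) n), ρ.toGaloisRep.IsIrreducible → IsGeometricFramed R ρ → ¬ (ρ.restrictField L).toGaloisRep.IsIrreducible → ∀ hcpt : Literature.NumberTheory.Automorphic.isCompact_glFiniteIntegralLevel n K, ∃ π : Literature.NumberTheory.Automorphic.CuspidalAutomorphicRepData n K hcpt, π.1.IsLAlgebraic ∧ ∀ᶠ v : IsDedekindDomain.HeightOneSpectrum (NumberField.RingOfIntegers K) in cofinite, SatakeFrobCompatibleAt ι π.1 ρ v := by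
  intro hAIf hHen hinf hdR K L _ _ _ _ _ _ R hp hRL _ n hn ℓ _ ι ρ hirr hgeo hred hcpt
  haveI : FiniteDimensional K L := Module.Finite.of_restrictScalars_finite ℚ K L
  have hcyc : IsCyclic (L ≃ₐ[K] L) :=
    BaseFieldAscentAscentConjugationSolvable.isCyclic_algEquiv_of_finrank_prime K L hp
  -- Clifford, strong form: `Q ρ Q⁻¹ = Ind s` with `s` irreducible of rank `m`, `n = [L:K]·m`
  obtain ⟨m, s, Q, e, hs, hconj⟩ :=
    exists_conj_eq_reindex_induce_of_not_isIrreducible_restrictField_of_prime K L hp ρ hirr hred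
  obtain rfl : n = Module.finrank K L * m := by simpa using (Fintype.card_congr e).symm
  have hm : 0 < m := hs.rank_pos
  -- `s` is geometric for the pinned datum over `L`
  obtain ⟨hsunr, hsdR⟩ :=
    isUnramifiedAt_and_isDeRhamFramed_of_conj_eq_reindex_induce hdR K L rfl ρ s Q e hconj hgeo.1 hgeo.2
  -- reciprocity over `L` in rank `m`: the cuspidal L-algebraic avatar `π_s` of `s`
  obtain ⟨R₁, hL⟩ := hRL
  have hcptL : isCompact_glFiniteIntegralLevel m L := isCompact_glFiniteIntegralLevel_holds m L
  obtain ⟨-, hBL⟩ := hL m hm hcptL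
  obtain ⟨πs, hπsL, hcorr⟩ := hBL ℓ ι s hs ⟨hsunr, hsdR⟩
  -- `π_s` is not `Gal(L/K)`-stable (else `ρ ∼ Ind(Res)` would be reducible)
  have hns : ¬ IsGaloisStableSatakeAE K πs.1 :=
    not_isGaloisStableSatakeAE_of_conj_eq_induce hp ρ hirr s hs Q e hconj ι πs.1 hcorr.1
  -- Arthur–Clozel automorphic induction, rank commuted to `[L:K]·m`
  obtain ⟨P, hAI⟩ : ∃ P : CuspidalAutomorphicRepData (Module.finrank K L * m) K hcpt,
      IsAutomorphicInductionAlong πs.1 P.1 :=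
    exists_isAutomorphicInductionAlong_of_rank_eq πs.1 (Nat.mul_comm m (Module.finrank K L))
      (isCompact_glFiniteIntegralLevel_holds _ K) hcpt
      (hAIf m K L hcyc hp hm hcptL (isCompact_glFiniteIntegralLevel_holds _ K) πs hns)
  -- `P` is L-algebraic (Henniart: induced infinity type)
  have hPL : P.1.IsLAlgebraic := by
    obtain ⟨Tπ, hTπ, hTπL⟩ := hπsL
    obtain ⟨TP, hTP⟩ := hinf _ K hcpt P.1
    exact ⟨_, hHen.hasInfinityType_automorphicInduction K L hcyc m (Module.finrank K L) hm rfl hcpt hcptL P πs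
      hAI hTP hTπ, hTπL.automorphicInduction⟩
  -- `P` is a.e. compatible with `Ind s = Q ρ Q⁻¹`, hence with `ρ`
  have hind : ∀ᶠ v : HeightOneSpectrum (𝓞 K) in cofinite,
      SatakeFrobCompatibleAt ι P.1 (FramedRep.reindex e (s.induce K rfl)) v :=
    IrreducibleOffSector.eventually_satakeFrobCompatibleAt_induce_rank ι πs.1 P.1 hAI s hcorr.1 rfl e
  have heq : FramedRep.reindex e (s.induce K (rfl : Module.finrank K L = Module.finrank K L)) =
      FramedRep.conj Q ρ :=
    ContinuousMonoidHom.ext fun x => Units.ext (by rw [FramedRep.coe_reindex_apply, hconj x])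
  refine ⟨P, hPL, ?_⟩
  filter_upwards [hind] with v hv
  rw [heq] at hv
  simpa only [FramedRep.conj_inv_conj_eq] using
    ReciprocityUpToIrreducibility.satakeFrobCompatibleAt_conj ι P.1 Q⁻¹ hv

end Summit.Langlands.Langlands.Theorems.SmithKummerSeedCyclicPrimeDescent

end
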